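import Summits.KontsevichZagierPeriods.KontsevichZagierPeriods.Theorems.LinRedNormalFormArrangementNormalFormSeparateTwoThinGood

/-!
# Angular non-degeneracy from a logarithmic contraction cost

(Line `janus-bands`, crux `ArrangementNormalForm`, stub `stub_separateTwoPos`, part `Angular`.)
The one-variable averaging step for the NON-EDGE poles on a thin sector adjacent to an atom /
polar / facet direction at a special point: if a weight `W ≥ 0` on `(0, ε)` moves towards the
direction `v → 0` at a logarithmic cost, `W(v) ≤ C (1 + log(v'/v))^K W(v')` for `v ≤ v' < ε`
(for the fibre mass: `SepTwo.lmass_contract` with contraction factor `s = v/v'`, constant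
`3 · wexp = O(1 + log(1/s))`), then its mass does not concentrate at the direction:
`∫⁻_{(0,ε)} W ≤ C' ∫⁻_{(ε/2,ε)} W` (`SepTwo.lintegral_le_of_logmono`), hence
`∫⁻_{(0,ε)} W ≤ C'' ∫⁻_{(0,ε)} v^j W` for every `j` (`SepTwo.lintegral_le_pow_of_logmono`,
registered as `separateTwo_angular`). This converts the absolute convergence of a monomial
`x^i v^j · (pole)` (part `MonoSplit`) into that of its Taylor pieces `x^i (v − a)^m · (pole)` at a
pole direction `a ∉ [0, ε]`, which are only `O(x^i)`. Tools: `SepTwo.thin_le_good` and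
`SepTwo.lintegral_logpow_le` of part `ThinGood`.
-/

noncomputable section

open Set MeasureTheory
open scoped ENNReal

namespace Summit.KontsevichZagierPeriods.ArrangementNormalForm.JanusBands

namespace SepTwo

/-- **No concentration at the direction.** See the module docstring. -/
theorem lintegral_le_of_logmono (W : ℝ → ℝ≥0∞) (hW : Measurable W) (K : ℕ) (C : ℝ≥0∞) {ε : ℝ}
    (hε : 0 < ε)
    (hlog : ∀ v v', 0 < v → v ≤ v' → v' < ε →
      W v ≤ C * ENNReal.ofReal ((1 + Real.log (v' / v)) ^ K) * W v') :
    ∫⁻ v in Ioo 0 ε, W v ≤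
      (C * ENNReal.ofReal (4 * (1 + 2 * K) ^ K) + 1) * ∫⁻ v in Ioo (ε / 2) ε, W v := by
  set T : Set ℝ := Ioo 0 (ε / 2) with hT
  set S : Set ℝ := Ioo (ε / 2) ε with hS
  set A : ℝ → ℝ≥0∞ := fun u => C * ENNReal.ofReal ((1 + Real.log (ε / u)) ^ K) with hA
  have hAm : Measurable A := by
    refine Measurable.const_mul (ENNReal.measurable_ofReal.comp ?_) _
    exact ((measurable_const.div measurable_id).log.const_add 1).pow_const K
  have hvolS : volume S = ENNReal.ofReal (ε / 2) := by
    rw [hS, Real.volume_Ioo]; congr 1; ring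
  -- pointwise comparison thin against good
  have hfg : ∀ u ∈ T, ∀ u' ∈ S, W u ≤ A u * W u' := by
    intro u hu u' hu'
    have hu0 : 0 < u := hu.1
    have huu' : u ≤ u' := by linarith [hu.2, hu'.1]
    refine (hlog u u' hu0 huu' hu'.2).trans ?_
    have h1 : 1 ≤ u' / u := (one_le_div hu0).2 huu'
    have h2 : u' / u ≤ ε / u := div_le_div_of_nonneg_right hu'.2.le hu0.le
    have h3 : 0 ≤ 1 + Real.log (u' / u) := by linarith [Real.log_nonneg h1]
    have h4 : (1 + Real.log (u' / u)) ^ K ≤ (1 + Real.log (ε / u)) ^ K :=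
      pow_le_pow_left₀ h3 (by linarith [Real.log_le_log (by positivity) h2]) K
    show C * ENNReal.ofReal ((1 + Real.log (u' / u)) ^ K) * W u' ≤
      C * ENNReal.ofReal ((1 + Real.log (ε / u)) ^ K) * W u'
    gcongr
  have hthin := thin_le_good measurableSet_Ioo measurableSet_Ioo
    (by rw [hvolS]; exact ENNReal.ofReal_ne_top) W W A hW.aemeasurable hAm hfg
  -- the logarithmic loss
  have hAint : ∫⁻ u in T, A u ≤ C * ENNReal.ofReal (2 * (1 + 2 * K) ^ K * ε) := by
    rw [hA, lintegral_const_mul _ (by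
      exact ENNReal.measurable_ofReal.comp
        (((measurable_const.div measurable_id).log.const_add 1).pow_const K))]
    gcongr
    calc ∫⁻ u in T, ENNReal.ofReal ((1 + Real.log (ε / u)) ^ K)
        ≤ ∫⁻ u in Ioo 0 ε, ENNReal.ofReal ((1 + Real.log (ε / u)) ^ K) :=
          lintegral_mono_set (Ioo_subset_Ioo le_rfl (by linarith))
      _ ≤ ENNReal.ofReal (2 * (1 + 2 * K) ^ K * ε) := lintegral_logpow_le K hε
  -- divide by the volume of the good set
  have hT_le : ∫⁻ u in T, W u ≤ C * ENNReal.ofReal (4 * (1 + 2 * K) ^ K) * ∫⁻ u' in S, W u' := by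
    have h1 : ENNReal.ofReal (ε / 2) * ∫⁻ u in T, W u ≤
        C * ENNReal.ofReal (2 * (1 + 2 * K) ^ K * ε) * ∫⁻ u' in S, W u' := by
      rw [← hvolS]; exact hthin.trans (mul_le_mul_left hAint _)
    have h2 : ENNReal.ofReal (2 / ε) * ENNReal.ofReal (ε / 2) = 1 := by
      rw [← ENNReal.ofReal_mul (by positivity)]
      rw [show 2 / ε * (ε / 2) = 1 by field_simp]; simp
    have h3 : ENNReal.ofReal (2 / ε) * ENNReal.ofReal (2 * (1 + 2 * K) ^ K * ε) =
        ENNReal.ofReal (4 * (1 + 2 * K) ^ K) := by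
      rw [← ENNReal.ofReal_mul (by positivity)]
      congr 1; field_simp; ring
    calc ∫⁻ u in T, W u = ENNReal.ofReal (2 / ε) * (ENNReal.ofReal (ε / 2) * ∫⁻ u in T, W u) := by
          rw [← mul_assoc, h2, one_mul]
      _ ≤ ENNReal.ofReal (2 / ε) * (C * ENNReal.ofReal (2 * (1 + 2 * K) ^ K * ε) * ∫⁻ u' in S, W u') :=
          mul_le_mul_right h1 _
      _ = C * ENNReal.ofReal (4 * (1 + 2 * K) ^ K) * ∫⁻ u' in S, W u' := by
          rw [← h3]; ring
  -- assemble
  have hsplit : Ioo 0 ε ⊆ T ∪ Icc (ε / 2) ε := by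
    intro u hu
    by_cases h : u < ε / 2
    · exact Or.inl ⟨hu.1, h⟩
    · exact Or.inr ⟨not_lt.1 h, hu.2.le⟩
  calc ∫⁻ v in Ioo 0 ε, W v ≤ ∫⁻ v in T ∪ Icc (ε / 2) ε, W v := lintegral_mono_set hsplit
    _ ≤ (∫⁻ v in T, W v) + ∫⁻ v in Icc (ε / 2) ε, W v := lintegral_union_le _ _ _
    _ = (∫⁻ v in T, W v) + ∫⁻ v in S, W v := by
        rw [hS, setLIntegral_congr (Ioo_ae_eq_Icc (a := ε / 2) (b := ε))]
    _ ≤ C * ENNReal.ofReal (4 * (1 + 2 * K) ^ K) * (∫⁻ u' in S, W u') + ∫⁻ v in S, W v :=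
        add_le_add hT_le le_rfl
    _ = (C * ENNReal.ofReal (4 * (1 + 2 * K) ^ K) + 1) * ∫⁻ v in S, W v := by ring

/-- **Angular non-degeneracy against powers.** Under the same hypothesis, for every `j`:
`∫⁻_{(0,ε)} W ≤ C'' ∫⁻_{(0,ε)} v^j W`. -/
theorem lintegral_le_pow_of_logmono (W : ℝ → ℝ≥0∞) (hW : Measurable W) (K : ℕ) (C : ℝ≥0∞)
    {ε : ℝ} (hε : 0 < ε)
    (hlog : ∀ v v', 0 < v → v ≤ v' → v' < ε →
      W v ≤ C * ENNReal.ofReal ((1 + Real.log (v' / v)) ^ K) * W v') (j : ℕ) :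
    ∫⁻ v in Ioo 0 ε, W v ≤ (C * ENNReal.ofReal (4 * (1 + 2 * K) ^ K) + 1) *
      ENNReal.ofReal ((2 / ε) ^ j) * ∫⁻ v in Ioo 0 ε, ENNReal.ofReal (v ^ j) * W v := by
  have h1 := lintegral_le_of_logmono W hW K C hε hlog
  have h2 : ∫⁻ v in Ioo (ε / 2) ε, W v ≤
      ENNReal.ofReal ((2 / ε) ^ j) * ∫⁻ v in Ioo (ε / 2) ε, ENNReal.ofReal (v ^ j) * W v := by
    have hm : Measurable fun v : ℝ => ENNReal.ofReal (v ^ j) * W v :=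
      (ENNReal.measurable_ofReal.comp (measurable_id.pow_const j)).mul hW
    rw [← lintegral_const_mul _ hm]
    refine setLIntegral_mono' measurableSet_Ioo fun v hv => ?_
    have hv0 : 0 < v := by linarith [hv.1]
    have h3 : 1 ≤ (2 / ε) ^ j * v ^ j := by
      rw [← mul_pow]
      exact one_le_pow₀ (by rw [div_mul_eq_mul_div, le_div_iff₀ hε]; linarith [hv.1])
    calc W v = 1 * W v := (one_mul _).symm
      _ ≤ ENNReal.ofReal ((2 / ε) ^ j * v ^ j) * W v := by
          gcongr
          rw [← ENNReal.ofReal_one]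
          exact ENNReal.ofReal_le_ofReal h3
      _ = ENNReal.ofReal ((2 / ε) ^ j) * (ENNReal.ofReal (v ^ j) * W v) := by
          rw [ENNReal.ofReal_mul (by positivity), mul_assoc]
  have h4 : ∫⁻ v in Ioo (ε / 2) ε, ENNReal.ofReal (v ^ j) * W v ≤
      ∫⁻ v in Ioo 0 ε, ENNReal.ofReal (v ^ j) * W v :=
    lintegral_mono_set (Ioo_subset_Ioo (by linarith) le_rfl)
  calc ∫⁻ v in Ioo 0 ε, W v
      ≤ (C * ENNReal.ofReal (4 * (1 + 2 * K) ^ K) + 1) * ∫⁻ v in Ioo (ε / 2) ε, W v := h1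
    _ ≤ (C * ENNReal.ofReal (4 * (1 + 2 * K) ^ K) + 1) *
        (ENNReal.ofReal ((2 / ε) ^ j) * ∫⁻ v in Ioo 0 ε, ENNReal.ofReal (v ^ j) * W v) :=
        mul_le_mul_right (h2.trans (mul_le_mul_right h4 _)) _
    _ = _ := by ring

end SepTwo

/-- **Angular non-degeneracy from a logarithmic contraction cost** (registered part of
`stub_separateTwoPos`; literal form of `SepTwo.lintegral_le_pow_of_logmono`): a measurable weight
on `(0, ε)` with `W(v) ≤ C (1 + log(v'/v))^K W(v')` for `0 < v ≤ v' < ε` satisfies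
`∫⁻_{(0,ε)} W ≤ (C · 4(1+2K)^K + 1) (2/ε)^j ∫⁻_{(0,ε)} v^j W` for every `j`. -/
theorem separateTwo_angular (W : ℝ → ENNReal) (hW : Measurable W) (K : ℕ) (C : ENNReal) (ε : ℝ) (hε : 0 < ε) (hlog : ∀ v v' : ℝ, 0 < v → v ≤ v' → v' < ε → W v ≤ C * ENNReal.ofReal ((1 + Real.log (v' / v)) ^ K) * W v') (j : ℕ) : MeasureTheory.lintegral (MeasureTheory.volume.restrict (Set.Ioo 0 ε)) W ≤ (C * ENNReal.ofReal (4 * (1 + 2 * K) ^ K) + 1) * ENNReal.ofReal ((2 / ε) ^ j) * MeasureTheory.lintegral (MeasureTheory.volume.restrict (Set.Ioo 0 ε)) (fun v => ENNReal.ofReal (v ^ j) * W v) := by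
  exact SepTwo.lintegral_le_pow_of_logmono W hW K C hε hlog j

end Summit.KontsevichZagierPeriods.ArrangementNormalForm.JanusBands
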